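import Summits.AtomisticToContinuum.FouriersLaw.Theses.PhononMeanFreePath
import Summits.AtomisticToContinuum.FouriersLaw.Theorems.PhononMeanFreePathDefs
import Summits.AtomisticToContinuum.FouriersLaw.Theorems.PhononMeanFreePathCoherentDephasingWeakCouplingIntegrability
import Summits.AtomisticToContinuum.FouriersLaw.Theorems.PhononMeanFreePathCoherentDephasingRightBalance
import Summits.AtomisticToContinuum.FouriersLaw.Theorems.PhononMeanFreePathCoherentDephasingResponseRegularity
import Summits.AtomisticToContinuum.FouriersLaw.Theorems.PhononMeanFreePathCoherentDephasingMeanFieldDuhamel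
import Summits.AtomisticToContinuum.FouriersLaw.Theorems.PhononMeanFreePathCoherentDephasingHarmFluxBound
import Summits.AtomisticToContinuum.FouriersLaw.Theorems.PhononMeanFreePathCoherentDephasingSiteBookkeeping
import Summits.AtomisticToContinuum.FouriersLaw.Theorems.PhononMeanFreePathCoherentDephasingTelescoping
import Summits.AtomisticToContinuum.FouriersLaw.Theorems.PhononMeanFreePathCoherentDephasingLossComposition
import Summits.AtomisticToContinuum.FouriersLaw.Theorems.PhononMeanFreePathCoherentDephasingOfLocalLossBound
import Summits.AtomisticToContinuum.FouriersLaw.Theorems.PhononMeanFreePathCoherentDephasingBlockLoss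

/-!
# Line `Sketch` (coherent-field Beer–Lambert) — crux `PhononMeanFreePath.CoherentDephasing` (stmt-AtomisticToContinuum-11810)

Lead prover's skeleton, **v5.3** (v5: lead `prover-line-stmt-AtomisticToContinuum-11810-0`, 2026-08-16, cycle 2; v4 = sitewise stub, v5 = its block average;
v5.1/v5.2: lead c2 `prover-line-stmt-AtomisticToContinuum-11810-c2-0`, 2026-08-17 — docstring only: the TEMPORAL menu entry and STRICT ABSORPTION below;
v5.3/v5.4: lead c3 `prover-line-stmt-AtomisticToContinuum-11810-c3-0`, 2026-08-17 — docstring only: NECESSITY chain (lifetime and weighted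
lifetime), RAY-MONOTONICITY / RAY-DOMINATION glue, the robust BULK + CONTACT glue, the POINTWISE / corner glue and the total-loss identity below;
composition unchanged).
The crux: for `P = pinnedChain ω₂ lam β γ` (all `> 0`), `T > 0`, with `r_N(t) = ∫ p₀ · (K_t p_N) dμ_T` over the
`(N+1)`-site chain, `(∀ N, r_N² ∈ L¹(0,∞)) ∧ N ∫₀^∞ r_N² → 0`.

**The line.** The Gibbs-averaged linear response field of the kick, `n_x = ⟨p₀, K_t q_x⟩`, `m_x = ⟨p₀, K_t p_x⟩`
(so `m_N = r_N`), solves EXACTLY the free-end pinned harmonic chain driven by the mean anharmonic polarisation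
`-lam c_x + β (d_x - d_{x-1})` and damped only at the two bath momenta, `m_x(0) = T δ_{x0}` (vocabulary:
`Theorems/PhononMeanFreePathDefs.lean`, sections CoherentField p86011 and SiteBookkeeping p88904). Its coherent site
energy `e_x = ½(m_x² + ω₂ n_x²) + ¼Σ_{b∋x}(n_{b+1} - n_b)²`, the symmetric harmonic flux `Ĵ_b = harmFlux b` and the site
work `s_x = siteWork x` (work done ON the mean anharmonic force at `x`) satisfy, at every fixed `N` (ALL LANDED):
* Duhamel equations of `(n, m)` — `stub_meanFieldDuhamel` **p90384** (worker W1; + KickDuhamel p89644, ResponseStatics p89987);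
* continuity / linearity / exponential decay — `stub_responseRegularity` **p89781** (W2; + CrossCorrelationContinuity p88855);
* site balances `Σ_b[b+1=x]Ĵ_b + [x=0]T²/2 = Σ_b[b=x]Ĵ_b + s_x + γ([x=0]+[x=N])∫₀^∞m_x²` and the transport bound
  `Ĵ_b ≤ E_b + E_{b+1}` (`E_x = cohEnergy x = ∫₀^∞ e_x ≥ 0`) — `stub_siteBookkeeping_of_meanField` **p89923** (W3);
and, UNIFORMLY IN `N` but ABSOLUTE:
* `harmFlux b ≤ B(ω₂, lam, β, γ, T)` at every bond of every chain — `stub_harmFluxBound` **p91449** (W4; from the tree's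
  Landauer/dissipation inequality `∫₀^∞ kickResp(F)² ≤ (T/2γ)‖F‖²`, p89774, and `N`-uniform Gibbs moments; the whole
  package of absolute bounds is `responseAbsBounds` p91897, W2).

**v4/v5 reshape: the `N`-uniform content is ONE stub.** With the TOTAL LOCAL LOSS
`s'_x := s_x + γ([x=0]+[x=N])∫₀^∞ m_x²` (anharmonic site work + bath dissipation, exactly the right-hand side of the landed
site balance), skeleton v4's single stub was the SITEWISE local Fermi-golden-rule / loss bound
`∃ L N₀ κ>0, ∀ N ≥ N₀, ∀ x ≥ L: κ · E_x ≤ s'_x`; its reduction to the crux is LANDED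
(`Theorems/…OfLocalLossBound.lean`, `coherentDephasing_of_localLossBound`, p94111; composition
`dissipation_le_geometric_loss` + `∫₀^∞ m_x² ≤ 2E_x`, `Theorems/…LossComposition.lean`, p93671). **v5 (this file) weakens the
stub to its BLOCK AVERAGE** `stub_blockLossBound : ∃ L₀ ≥ 1, L, N₀, κ>0, ∀ N ≥ N₀, ∀ blocks x…x+L₀-1 beyond the head:
κ Σ_block E ≤ Σ_block s'` (implied by the sitewise form, `blockLossBound_of_localLossBound` below; the natural output of any
coarse-graining over a few mean free paths), whose reduction to the crux is LANDED as well (`Theorems/…BlockLoss.lean`,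
`coherentDephasing_of_blockLossBound`: coarse-grain into blocks of `L₀` sites ending at the far bath and apply the sitewise
lemma to block-boundary fluxes / block losses / block energies). Either form implies the v3 stubs (bulk passivity, bulk local
FGR, contact bound: at `x = N`, `s'_N = Ĵ_{N-1}` and `γ∫m_N² ≤ 2γE_N`) and the route-A stubs of v1–v3 (dropped). Composition:
balance + loss bound ⇒ the (block-boundary) flux `Ĵ` is non-increasing and `≥ 0` beyond the head and contracts by `1/(1+κ)`
every two steps, so `γ∫₀^∞ r_N² ≤ (2γ/κ)·B·(1+κ)^{-⌊(⌊(N-L)/L₀⌋-1)/2⌋}` and `N θ^{(N-c)/L'} → 0` (`tendsto_natMul_pow_div`,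
p87005). `CoherentDephasing_of` concludes the crux BY NAME.

MD evidence for the stub (kit j015100, `(ω₂,lam,β,γ,T) = (1,1,1,1,1)`, `N = 8,16,24`, `R = 256` replicas, `2.5·10⁷` time
units): every site work and bond work is POSITIVE at every site and bond INCLUDING the far contact (`a_N = +5.7(2)·10⁻⁵`,
`absorbedWork(N-1)/γ∫m_N² = +0.078(2)` at `N = 24`; the v3 docstring's "`siteWork N < 0`" came from a noisier run), the
profiles `Ĵ_b`, `a_x` are `N`-independent to 3 digits, and `Ĵ_{b+4}/Ĵ_b = 0.47 … 0.42` (Beer–Lambert, `ℓ ≈ 4.7`).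
Profiles of `κ_x = s'_x/E_x` on four coupling rays, `N ≤ 64`: `Cruxes/CoherentDephasing/LossBoundNumerics.md` (positive everywhere; see the stub docstring).

**v5.1 (lead c2, 2026-08-17): the TEMPORAL menu entry (landed, p132858,
`Theorems/PhononMeanFreePathCoherentDephasingTimeWeighted.lean`).** Independently of the block-loss stub below, the crux
follows from ONE `N`-uniform time-moment of order `> 1` of the squared response:
`coherentDephasing_of_timeWeightedResponse : (∀ params, ∃ a > 1, ∃ C, ∀ N R, 0 < R → ∫_{(0,R]} (1+t)^a r_N(t)² dt ≤ C) →
CoherentDephasing` (landed sub-ballistic light cone `stub_lightCone` p92940 of the sibling crux 11811 + weighted tail;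
pointwise-envelope form `r_N² ≤ C(1+t)^{-s}`, `s > 2`, and the one-particle-sector form with `Σ_x e_x(t)` in place of
`r_N²` are landed next to it). The moment of order `0` is the PROVED Landauer bound `∫₀^∞ r_N² ≤ T²/(2γ)`; so along the
time axis the crux is exactly "one moment beyond Landauer, uniformly in `N`" (finite thermal phonon LIFETIME), while the
stub below is its spatial/mechanistic form (finite mean free PATH via local absorption). Neither implies the other
formally; both are false at `lam = β = 0`. The composition `CoherentDephasing_of` of this skeleton is unchanged (v5).

**v5.2 (lead c2, cycle 2, 2026-08-17): N-UNIFORM STRICT ABSORPTION landed** (`Theorems/PhononMeanFreePathCoherentDephasingStrictAbsorption.lean`,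
`strictAbsorption : ∀ params, ∃ c > 0, ∀ N ≥ 2, γ(∫₀^∞ m_0² + ∫₀^∞ m_N²) ≤ T²/2 − c`, i.e. `W_N ≥ c` with the landed total
balance; 13 supporting files `…StrictAbsorption*.lean`, 7 by workers). This is the head-block, first-window instance of the
loss bound below (a fixed N-independent amount of the kick is dephased at the kicked site, by the which-path variance of the
averaged tangent response against the thermal curvature `Φ = U''(q₀)+V''(q₁−q₀)`); it uses `lam + β > 0` essentially and is
`0` harmonically. It does not change the composition of this skeleton: the crux still needs the bound for every block the
signal reaches (`stub_blockLossBound`, unchanged).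

**v5.3/v5.4 (lead c3, 2026-08-17): landed reductions around the open stub (all `--supports`, sorry-free; v5.4 adds S1 ⇒ S3
`weightedLifetime_of_blockLossBound` p137792 (`Theorems/…WeightedLifetimeOfBlockLoss.lean`: block loss ⇒ `∃ C, ∀ N, Σ_x (x+1)²E_x ≤ C`,
composing with p132210), the ray-DOMINATION glue `coherentDephasing_of_weakCoupling_of_rayDomination` p137473 (constant factor and threshold
allowed in the ray comparison), the POINTWISE glue `sliceAt_of_blockLossBoundAt` + `coherentDephasingWeakCoupling_of_cornerBlockLossBound`
p137916 (`Theorems/…BlockLossPointwise.lean`: the block loss bound at ONE parameter point gives the crux's slice there, so the bound on the corner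
`lam·T, β·T ≤ ε₀` gives the support item stmt-11813), and the exact identity `sum_totalLocalLoss_eq` p137851 (`Σ_x s'_x = T²/2`, every `N`); v5.5 adds the N-UNIFORM POINTWISE-IN-TIME bounds of
the coherent field `sum_momResp_sq_le` p141661 (`Σ_x m_x(t)² ≤ T²`: detailed balance + Bessel for the orthonormal momenta + L² contraction),
`sum_posResp_sq_le` p141762 (`Σ_x n_x(t)² ≤ T²/min(ω₂,1)`: duality + the N-uniform Gibbs Poincaré inequality) and `sum_cohEnergyDensity_le`
p142595 (`Σ_x e_x(t) ≤ T²(½ + (ω₂/2+2)/min(ω₂,1))` for all N, t > 0: the coherent field never holds more than a fixed multiple of the kick energy —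
the absolute layer is now complete pointwise in time as well as time-integrated per site)).**
* NECESSITY above the stub — `lifetimeBound_of_blockLossBound` (`Theorems/PhononMeanFreePathCoherentDephasingLifetimeOfBlockLoss.lean`,
  p136570): the block loss bound below implies the `N`-uniform coherent LIFETIME bound `∃ B N₀, ∀ N ≥ N₀, Σ_x E_x^{(N)} ≤ B`
  (`B = (max L 1 + L₀)·B_abs + B_abs/κ`; tiling from the far bath + telescoped site balances `Σ_{x ≥ a} s'_x = Ĵ_{a-1} ≤ B_abs`).
  `Σ_x E_x = ∫₀^∞ Σ_x e_x(t) dt` is the total time-integrated coherent (one-particle-sector) energy — `≈ T²ℓ/(2v)` physically,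
  `+∞` harmonically in the limit (ballistic spreading, `~ N`); it is the GLOBAL/averaged form of the stub (with `Σ_x s'_x = T²/2`
  the average loss ratio is `≥ T²/(2B)`), and the cheapest falsification target for the disprover: `Σ_x E_x^{(N)}` growing with `N`
  on any admissible ray kills `stub_blockLossBound` (not the crux).
* RAY MONOTONICITY glue — `coherentDephasing_of_weakCoupling_of_rayMonotone` (`Theorems/PhononMeanFreePathCoherentDephasingRayMonotone.lean`,
  p136163): `CoherentDephasingWeakCoupling (stmt-11813) ∧ (∀ ω₂ a b γ > 0, ∀ g ≥ 1, ∀ N: ∫₀^∞ r_N(g a, g b; T=1)² ≤ ∫₀^∞ r_N(a, b; 1)²,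
  with integrability) → CoherentDephasing` — the thesis of cards heating-never-recoheres / scaling-ward-monotone-transfer as a theorem
  (landed ScalingNormalForm: the temperature axis IS the coupling ray, so "the scale-free coherent transmission `N∫r_N²/T²` does not
  increase on heating" transfers the kinetic corner to every coupling). A reduction of a different TYPE (fixed-`N` comparison in the
  couplings + the existing corner item); MD (Disproof.lean, 81 points): monotone at every `N ≤ 128` on all rays with `lam > 0`,
  violated exactly on the excluded boundary `lam = 0`.
* ROBUST BULK + CONTACT glue — `coherentDephasing_of_bulkBlockLoss_of_contactBound` (`Theorems/PhononMeanFreePathCoherentDephasingBulkContact.lean`,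
  p137053): the crux already follows from (i) the block loss bound for BULK blocks only (`L ≤ x`, `x + L₀ + K ≤ N`: blocks at
  distance `≥ K+1` from the far bath, no bath term) together with (ii) a CONTACT BOUND `γ∫₀^∞ m_N² ≤ (1+C)·max(Ĵ_{N-K-1}, 0)` (the far
  bath dissipates coherently at most `(1+C)×` the coherent HARMONIC flux entering the last `K+1` sites; `C = 0` ⇔ passivity of
  the contact region in the `siteWork` attribution). ATTRIBUTION NOTE: in the `siteWork`/`harmFlux` bookkeeping the work of a bond's
  cubic force is split between its two sites, and at the far contact the last site's share is NEGATIVE whenever `β` is not small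
  (c0, `LossBoundNumerics.md`: `siteWork_N = -0.996e-4`, `Ĵ_{N-1} = 1.111e-4`, `γ∫m_N² = 2.118e-4` at `N = 128` on ray `(0.1,1)`, i.e.
  `γ∫m_N² ≈ 1.9·Ĵ_{N-1}`: `C ≈ 1` at `K = 0`), while in the full-bond-force attribution (`cohFlux`, `absorbedWork`) the contact is
  strictly passive (`absorbedWork(N-1)/γ∫m_N² = +0.078(2)` at `(1,1,1,1,1)`); hence the `(1+C)` and the depth `K` in (ii). This pair is
  the reshape target should the block ratio `κ` degrade in a boundary layer of fixed width at the far contact (the one documented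
  numerical doubt, ray `(0.1,1)`, last ≈ 15 sites of `N = 128` reading 1.5–2σ low); a v6 candidate skeleton with the two stubs
  (`stub_bulkBlockLossBound`, `stub_contactBound`, assembly via p137053, rc 0) is kept UNREGISTERED in the lead's folder.

Disproof.lean (cdisprove, 07:03Z) honoured: anharmonicity is used exactly in `stub_blockLossBound` (§3: at `lam = β = 0`,
`s_x ≡ 0` in the bulk and the bound fails — `HarmonicCoherentPersistence`); nothing is `T`-uniform (§4, §8: `κ, L, N₀`
depend on `(ω₂, lam, β, γ, T)`); the kill switches (§7) are exactly a failure of the loss bound with a flux plateau;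
`-- Targets`: none posted.
-/

noncomputable section

open MeasureTheory Set Filter Topology

namespace Summit.AtomisticToContinuum.FouriersLaw.Cruxes.CoherentDephasing.CoherentFieldBeerLambert

open Literature.MathematicalPhysics.KineticTheory.HeatConduction (pinnedChain PhaseSpace)
open Summit.AtomisticToContinuum.FouriersLaw.Theses.PhononMeanFreePath (CoherentDephasing)
open Summit.AtomisticToContinuum.FouriersLaw.Theorems.PhononMeanFreePath
open Summit.AtomisticToContinuum.FouriersLaw.Theorems.CoherentDephasing.Telescoping (tendsto_natMul_pow_div)

/-! ## Landed stubs (fixed `N`, and the absolute `N`-uniform flux bound) — one-line references to `Theorems/` files -/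

/-- STUB (fixed `N`, stochastic → ODE; **LANDED p90384**). **Duhamel form of the mean-field equations of the coherent
response field**: for every admissible parameter point, every `N` and `t ≥ 0`, `n_x(t) = ∫₀ᵗ m_x` and
`m_x(t) = T·[x = 0] + ∫₀ᵗ ( -ω₂ n_x - lam c_x + Σ_b ([b = x] - [b+1 = x]) F_b - γ([x = 0] + [x = N]) m_x )`. -/
theorem stub_meanFieldDuhamel :
    ∀ ω₂ lam β γ : ℝ, 0 < ω₂ → 0 < lam → 0 < β → 0 < γ → ∀ T : ℝ, 0 < T → ∀ N : ℕ,
      (∀ (x : Fin (N + 1)) (t : ℝ), 0 ≤ t →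
          posResp ω₂ lam β γ T N x t = ∫ s in (0 : ℝ)..t, momResp ω₂ lam β γ T N x s) ∧
      (∀ (x : Fin (N + 1)) (t : ℝ), 0 ≤ t →
          momResp ω₂ lam β γ T N x t = (if (x : ℕ) = 0 then T else 0) +
            ∫ s in (0 : ℝ)..t, (-(ω₂ * posResp ω₂ lam β γ T N x s) - lam * cubeResp ω₂ lam β γ T N x s +
              (∑ b : Fin N, ((if (b : ℕ) = (x : ℕ) then bondForceResp ω₂ lam β γ T N b s else 0) -
                (if (b : ℕ) + 1 = (x : ℕ) then bondForceResp ω₂ lam β γ T N b s else 0))) -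
              γ * ((if (x : ℕ) = 0 then 1 else 0) + (if (x : ℕ) = N then 1 else 0)) *
                momResp ω₂ lam β γ T N x s)) :=
  Summit.AtomisticToContinuum.FouriersLaw.Theorems.CoherentDephasing.MeanFieldDuhamel.stub_meanFieldDuhamel

/-- STUB (fixed `N`, regularity and decay; **LANDED p89781**). Continuity of `m_x, n_x, c_x, d_b`, linearity
`F_b = (n_{b+1} - n_b) + β d_b`, and exponential decay `|m_x|,|n_x|,|c_x|,|d_b| ≤ C e^{-ct}` on `t ≥ 0`. -/
theorem stub_responseRegularity :
    ∀ ω₂ lam β γ : ℝ, 0 < ω₂ → 0 < lam → 0 < β → 0 < γ → ∀ T : ℝ, 0 < T → ∀ N : ℕ,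
      (∀ x : Fin (N + 1), Continuous (momResp ω₂ lam β γ T N x) ∧ Continuous (posResp ω₂ lam β γ T N x) ∧
          Continuous (cubeResp ω₂ lam β γ T N x)) ∧
      (∀ b : Fin N, Continuous (stretchCubeResp ω₂ lam β γ T N b)) ∧
      (∀ (b : Fin N) (t : ℝ), bondForceResp ω₂ lam β γ T N b t =
          posResp ω₂ lam β γ T N b.succ t - posResp ω₂ lam β γ T N b.castSucc t +
            β * stretchCubeResp ω₂ lam β γ T N b t) ∧
      (∃ C c : ℝ, 0 < c ∧ ∀ t : ℝ, 0 ≤ t →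
          (∀ x : Fin (N + 1), |momResp ω₂ lam β γ T N x t| ≤ C * Real.exp (-c * t) ∧
              |posResp ω₂ lam β γ T N x t| ≤ C * Real.exp (-c * t) ∧
              |cubeResp ω₂ lam β γ T N x t| ≤ C * Real.exp (-c * t)) ∧
          (∀ b : Fin N, |stretchCubeResp ω₂ lam β γ T N b t| ≤ C * Real.exp (-c * t))) :=
  Summit.AtomisticToContinuum.FouriersLaw.Theorems.CoherentDephasing.ResponseRegularity.stub_responseRegularity

/-- STUB (fixed `N`, pure real analysis; **LANDED p89923**). **Sitewise bookkeeping of the coherent field**: under the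
Duhamel equations and the regularity/decay facts, at every site `x`
`Σ_b [b+1 = x] Ĵ_b + [x = 0]·T²/2 = Σ_b [b = x] Ĵ_b + s_x + γ([x=0]+[x=N]) ∫₀^∞ m_x²`, and `Ĵ_b ≤ E_b + E_{b+1}` at every
bond. -/
theorem stub_siteBookkeeping_of_meanField :
    ∀ ω₂ lam β γ : ℝ, 0 < ω₂ → 0 < lam → 0 < β → 0 < γ → ∀ T : ℝ, 0 < T → ∀ N : ℕ,
      ((∀ (x : Fin (N + 1)) (t : ℝ), 0 ≤ t →
          posResp ω₂ lam β γ T N x t = ∫ s in (0 : ℝ)..t, momResp ω₂ lam β γ T N x s) ∧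
        (∀ (x : Fin (N + 1)) (t : ℝ), 0 ≤ t →
          momResp ω₂ lam β γ T N x t = (if (x : ℕ) = 0 then T else 0) +
            ∫ s in (0 : ℝ)..t, (-(ω₂ * posResp ω₂ lam β γ T N x s) - lam * cubeResp ω₂ lam β γ T N x s +
              (∑ b : Fin N, ((if (b : ℕ) = (x : ℕ) then bondForceResp ω₂ lam β γ T N b s else 0) -
                (if (b : ℕ) + 1 = (x : ℕ) then bondForceResp ω₂ lam β γ T N b s else 0))) -
              γ * ((if (x : ℕ) = 0 then 1 else 0) + (if (x : ℕ) = N then 1 else 0)) *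
                momResp ω₂ lam β γ T N x s))) →
      ((∀ x : Fin (N + 1), Continuous (momResp ω₂ lam β γ T N x) ∧ Continuous (posResp ω₂ lam β γ T N x) ∧
          Continuous (cubeResp ω₂ lam β γ T N x)) ∧
        (∀ b : Fin N, Continuous (stretchCubeResp ω₂ lam β γ T N b)) ∧
        (∀ (b : Fin N) (t : ℝ), bondForceResp ω₂ lam β γ T N b t =
          posResp ω₂ lam β γ T N b.succ t - posResp ω₂ lam β γ T N b.castSucc t +
            β * stretchCubeResp ω₂ lam β γ T N b t) ∧
        (∃ C c : ℝ, 0 < c ∧ ∀ t : ℝ, 0 ≤ t →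
          (∀ x : Fin (N + 1), |momResp ω₂ lam β γ T N x t| ≤ C * Real.exp (-c * t) ∧
              |posResp ω₂ lam β γ T N x t| ≤ C * Real.exp (-c * t) ∧
              |cubeResp ω₂ lam β γ T N x t| ≤ C * Real.exp (-c * t)) ∧
          (∀ b : Fin N, |stretchCubeResp ω₂ lam β γ T N b t| ≤ C * Real.exp (-c * t)))) →
      (∀ x : Fin (N + 1), (∑ b : Fin N, if (b : ℕ) + 1 = (x : ℕ) then harmFlux ω₂ lam β γ T N b else 0) +
          (if (x : ℕ) = 0 then T ^ 2 / 2 else 0) =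
        (∑ b : Fin N, if (b : ℕ) = (x : ℕ) then harmFlux ω₂ lam β γ T N b else 0) + siteWork ω₂ lam β γ T N x +
          γ * ((if (x : ℕ) = 0 then 1 else 0) + (if (x : ℕ) = N then 1 else 0)) *
            ∫ t in Ioi (0 : ℝ), momResp ω₂ lam β γ T N x t ^ 2) ∧
      (∀ b : Fin N, harmFlux ω₂ lam β γ T N b ≤ cohEnergy ω₂ lam β γ T N b.castSucc + cohEnergy ω₂ lam β γ T N b.succ) :=
  Summit.AtomisticToContinuum.FouriersLaw.Theorems.CoherentDephasing.SiteBookkeeping.stub_siteBookkeeping_of_meanField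

/-- STUB (`N`-UNIFORM but ABSOLUTE; **LANDED p91449**). **Uniform bound on the coherent harmonic flux**:
`harmFlux b ≤ B(ω₂, lam, β, γ, T)` for every `N` and every bond `b`. -/
theorem stub_harmFluxBound :
    ∀ ω₂ lam β γ : ℝ, 0 < ω₂ → 0 < lam → 0 < β → 0 < γ → ∀ T : ℝ, 0 < T →
      ∃ B : ℝ, ∀ (N : ℕ) (b : Fin N), harmFlux ω₂ lam β γ T N b ≤ B :=
  Summit.AtomisticToContinuum.FouriersLaw.Theorems.CoherentDephasing.HarmFluxBound.stub_harmFluxBound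

/-! ## THE open stub (registered; the only `sorry` of the line) — v5: BLOCK form -/

/-- STUB (`N`-UNIFORM, RELATIVE; the line's single load-bearing statement, held by the lead; v5 = block form).
**Block loss (FGR) bound of the coherent response field.** For every admissible parameter point there are a block length
`L₀ ≥ 1`, a head margin `L`, a threshold `N₀` and a rate `κ > 0` such that in every chain with `N ≥ N₀`, for every block of
`L₀` consecutive sites `x, …, x + L₀ - 1` beyond the head (`x ≥ L`, `x + L₀ ≤ N + 1`), the TOTAL LOCAL LOSS of the
Gibbs-averaged response field summed over the block — site work on the mean anharmonic force plus, at a bath site, the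
dissipation `γ∫₀^∞ m_x²` — is at least `κ ×` the time-integrated coherent energy summed over the block:
`κ Σ_{i<L₀} cohEnergy (x+i) ≤ Σ_{i<L₀} (siteWork (x+i) + γ([x+i = 0] + [x+i = N]) ∫₀^∞ m_{x+i}²)`.
Physically `κ ≈ Γ = v/ℓ` (finite thermal phonon lifetime, uniformly in the length), `L₀` a few mean free paths; the
sitewise form (`L₀ = 1`, skeleton v4's `stub_localLossBound`, reduction landed p94111) implies it; false at `lam = β = 0`
(`siteWork ≡ 0` while the coherent energy persists: `HarmonicCoherentPersistence`). MD (`Cruxes/…/LossBoundNumerics.md`,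
kit j016094–97, `T = ω₂ = γ = 1`): the SITEWISE ratio `κ_x` is positive at every site of every chain on all four rays
tested and the bound holds with `L₀ = L = 1`: `κ = 0.048` at `(lam,β) = (1,1)` (`N ≤ 32`), `0.050` at `(1,0.1)`, `0.018` at
`(0.3,0.3)` (`N ≤ 48`, `N`-independent to 3 digits, minimum at `x = 1`), and `≈ 0.012` at `(0.1,1)` where `κ_x` falls along
the chain (spectral narrowing) to a plateau `0.013–0.015` that persists at `N = 64, 96, 128` with a constant asymptotic
attenuation `0.958`/site (`ℓ_∞ ≈ 23`). -/
theorem stub_blockLossBound :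
    ∀ ω₂ lam β γ : ℝ, 0 < ω₂ → 0 < lam → 0 < β → 0 < γ → ∀ T : ℝ, 0 < T →
      ∃ L₀ L N₀ : ℕ, ∃ κ : ℝ, 0 < L₀ ∧ 0 < κ ∧ ∀ N : ℕ, N₀ ≤ N → ∀ (x : ℕ) (hx : x + L₀ ≤ N + 1), L ≤ x →
        κ * ∑ i : Fin L₀, cohEnergy ω₂ lam β γ T N ⟨x + i, by omega⟩ ≤
          ∑ i : Fin L₀, (siteWork ω₂ lam β γ T N ⟨x + i, by omega⟩ +
            γ * ((if x + (i : ℕ) = 0 then 1 else 0) + (if x + (i : ℕ) = N then 1 else 0)) *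
              ∫ t in Set.Ioi (0 : ℝ), momResp ω₂ lam β γ T N ⟨x + i, by omega⟩ t ^ 2) := by
  sorry

/-! ## The sitewise form (v4 stub) implies the block form — kept as the documented stronger sufficient condition -/

/-- The SITEWISE local loss bound (skeleton v4's stub; its reduction to the crux is the landed
`coherentDephasing_of_localLossBound`, p94111) implies the block bound with `L₀ = 1`. [folklore] -/
theorem blockLossBound_of_localLossBound
    (h : ∀ ω₂ lam β γ : ℝ, 0 < ω₂ → 0 < lam → 0 < β → 0 < γ → ∀ T : ℝ, 0 < T →
      ∃ L N₀ : ℕ, ∃ κ : ℝ, 0 < κ ∧ ∀ N : ℕ, N₀ ≤ N → ∀ x : Fin (N + 1), L ≤ (x : ℕ) →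
        κ * cohEnergy ω₂ lam β γ T N x ≤ siteWork ω₂ lam β γ T N x +
          γ * ((if (x : ℕ) = 0 then 1 else 0) + (if (x : ℕ) = N then 1 else 0)) *
            ∫ t in Ioi (0 : ℝ), momResp ω₂ lam β γ T N x t ^ 2) :
    ∀ ω₂ lam β γ : ℝ, 0 < ω₂ → 0 < lam → 0 < β → 0 < γ → ∀ T : ℝ, 0 < T →
      ∃ L₀ L N₀ : ℕ, ∃ κ : ℝ, 0 < L₀ ∧ 0 < κ ∧ ∀ N : ℕ, N₀ ≤ N → ∀ (x : ℕ) (hx : x + L₀ ≤ N + 1), L ≤ x →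
        κ * ∑ i : Fin L₀, cohEnergy ω₂ lam β γ T N ⟨x + i, by omega⟩ ≤
          ∑ i : Fin L₀, (siteWork ω₂ lam β γ T N ⟨x + i, by omega⟩ +
            γ * ((if x + (i : ℕ) = 0 then 1 else 0) + (if x + (i : ℕ) = N then 1 else 0)) *
              ∫ t in Set.Ioi (0 : ℝ), momResp ω₂ lam β γ T N ⟨x + i, by omega⟩ t ^ 2) := by
  intro ω₂ lam β γ hω hl hβ hγ T hT
  obtain ⟨L, N₀, κ, hκ, hloc⟩ := h ω₂ lam β γ hω hl hβ hγ T hT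
  refine ⟨1, L, N₀, κ, Nat.one_pos, hκ, fun N hN x hx hLx => ?_⟩
  have h1 := hloc N hN ⟨x, by omega⟩ hLx
  simp only [Fin.sum_univ_one, Fin.val_zero, add_zero]
  exact h1

/-! ## The crux from the stubs -/

/-- **Assembly (v5).** `CoherentDephasing` (the route decl, by name) = the landed CONDITIONAL reduction
`coherentDephasing_of_blockLossBound` (`Theorems/PhononMeanFreePathCoherentDephasingBlockLoss.lean`: fixed-`N` layer
p90384/p89781/p89923, absolute flux bound p91449, `∫m_x² ≤ 2E_x` + sitewise composition p93671, coarse-graining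
`dissipation_le_geometric_blockLoss`, `tendsto_natMul_pow_div` p87005) applied to the single open stub
`stub_blockLossBound`. -/
theorem CoherentDephasing_of : CoherentDephasing :=
  Summit.AtomisticToContinuum.FouriersLaw.Theorems.CoherentDephasing.BlockLoss.coherentDephasing_of_blockLossBound
    stub_blockLossBound

end Summit.AtomisticToContinuum.FouriersLaw.Cruxes.CoherentDephasing.CoherentFieldBeerLambert

end
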